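import Summits.MatrixMultiplication.OmegaCensus.STPP211Z2pow6Hard01Class
import Summits.MatrixMultiplication.OmegaCensus.STPP211Z2pow6Hard02Class
import Summits.MatrixMultiplication.OmegaCensus.STPP211Z2pow6Hard03Class
import Summits.MatrixMultiplication.OmegaCensus.STPP211Z2pow6Hard04Class
import Summits.MatrixMultiplication.OmegaCensus.STPP211Z2pow6Hard05Class
import Summits.MatrixMultiplication.OmegaCensus.STPP211Z2pow6Hard06Class
import Summits.MatrixMultiplication.OmegaCensus.STPP211Z2pow6Hard07Class
import Summits.MatrixMultiplication.OmegaCensus.STPP211Z2pow6Hard08Class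
import Summits.MatrixMultiplication.OmegaCensus.STPP211Z2pow6Hard09Class
import Summits.MatrixMultiplication.OmegaCensus.STPP211Z2pow6Hard10Class
import Summits.MatrixMultiplication.OmegaCensus.STPP211Z2pow6Hard11Class
import Summits.MatrixMultiplication.OmegaCensus.STPP211Z2pow6RepNF
import Summits.MatrixMultiplication.OmegaCensus.STPPSmallPatternT1K9Z2pow6

/-!
# (2,1,1)¹⁰ ⊄ (ℤ/2)⁶ — THE THRESHOLD `T1((ℤ/2)⁶) = 9` IN THE KERNEL (assembly)

Cell `pub-omega` (unit `pub-omega-stpp-1-g37`), topic `Summits/MatrixMultiplication/OmegaCensus`.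
HONEST FRAMING (verbatim): lottery ticket; floor = certified bounds/negative ranges. Census STRUCTURE bookkeeping (B5, `T1((ℤ/2)⁶)`, Pb237);
nothing here is a bound on `ω`.

**`not_exists_isSTPP_211pow10_z2pow6`: there is NO STPP family of size pattern `(2,1,1)¹⁰` in `(ℤ/2)⁶`** — from `T1Z2p6.exists_hard11NF`
(every such family has a normal form over one of the 11 hard `c`-classes; `STPP211Z2pow6RepNF`: frame normal forms, the 44 672-frame cover,
456 orbit certificates, 18 coset-law exclusions) and the eleven direct-search exclusions `T1CosetEng.noNF_cs07 … noNF_cs27`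
(`STPP211Z2pow6Hard01Class … Hard11Class`: g36's lane-packed direct engine at symmetry-reduced roots, chunked; 24 181 865 kernel search calls in
all). With ENG2 g35's witness `exists_isSTPP_211pow9_z2pow6` this is `T1((ℤ/2)⁶) = 9` exactly (`stpp211_z2pow6_threshold`), and by
restriction no `(2,1,1)ᵏ` family exists for any `k ≥ 10` (`not_exists_isSTPP_211_z2pow6_of_le`).

References: H. Cohn, R. Kleinberg, B. Szegedy, C. Umans, FOCS 2005 (arXiv:math/0511460), Def. 5.1.
-/

namespace Summit.MatrixMultiplication.OmegaCensus

namespace T1Z2p6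

open Finset Literature.Computability.AlgebraicComplexity T1CosetEng

/-- **NO `(2,1,1)¹⁰` STPP FAMILY IN `(ℤ/2)⁶`.** [cite: CohnKleinbergSzegedyUmans2005, Def. 5.1] -/
theorem not_exists_isSTPP_211pow10_z2pow6 :
    ¬ ∃ A B C : Fin 10 → Finset G6, IsSTPP A B C ∧ ∀ i, (A i).card = 2 ∧ (B i).card = 1 ∧ (C i).card = 1 := by
  rintro ⟨A, B, C, hS, hc⟩
  obtain ⟨r, hr, A', hst, hcard⟩ := exists_hard11NF hS hc
  have hex : ∃ A : Fin 10 → Finset G6, IsSTPP A (fun _ => ({0} : Finset G6)) (fun i => {dec (r.getD i.val 0)}) ∧ ∀ i, (A i).card = 2 :=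
    ⟨A', hst, hcard⟩
  simp only [hard11, List.mem_cons, List.not_mem_nil, or_false] at hr
  rcases hr with rfl | rfl | rfl | rfl | rfl | rfl | rfl | rfl | rfl | rfl | rfl
  exacts [noNF_cs07 hex, noNF_cs08 hex, noNF_cs09 hex, noNF_cs11 hex, noNF_cs17 hex, noNF_cs20 hex, noNF_cs21 hex, noNF_cs22 hex, noNF_cs23 hex, noNF_cs25 hex, noNF_cs27 hex]

/-- **No `(2,1,1)ᵏ` STPP family in `(ℤ/2)⁶` for any `k ≥ 10`** (restrict to the first ten members). [cite: CohnKleinbergSzegedyUmans2005, Def. 5.1] -/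
theorem not_exists_isSTPP_211_z2pow6_of_le {k : ℕ} (hk : 10 ≤ k) :
    ¬ ∃ A B C : Fin k → Finset G6, IsSTPP A B C ∧ ∀ i, (A i).card = 2 ∧ (B i).card = 1 ∧ (C i).card = 1 := by
  rintro ⟨A, B, C, hS, hc⟩
  let ι : Fin 10 → Fin k := Fin.castLE hk
  have hι : Function.Injective ι := Fin.castLE_injective hk
  exact not_exists_isSTPP_211pow10_z2pow6 ⟨A ∘ ι, B ∘ ι, C ∘ ι, hS.comp_of_injective ι hι, fun i => hc (ι i)⟩

/-- **`T1((ℤ/2)⁶) = 9`:** `(2,1,1)⁹ ⊆ (ℤ/2)⁶` (ENG2 g35's kernel witness) and `(2,1,1)¹⁰ ⊄ (ℤ/2)⁶`. [cite: CohnKleinbergSzegedyUmans2005, Def. 5.1] -/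
theorem stpp211_z2pow6_threshold :
    (∃ A B C : Fin 9 → Finset G6, IsSTPP A B C ∧ ∀ i, (A i).card = 2 ∧ (B i).card = 1 ∧ (C i).card = 1) ∧
    ¬ ∃ A B C : Fin 10 → Finset G6, IsSTPP A B C ∧ ∀ i, (A i).card = 2 ∧ (B i).card = 1 ∧ (C i).card = 1 :=
  ⟨exists_isSTPP_211pow9_z2pow6, not_exists_isSTPP_211pow10_z2pow6⟩

end T1Z2p6

end Summit.MatrixMultiplication.OmegaCensus
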